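import Literature.Topology.FourManifolds.SphereSurgeryHomology
import Literature.Topology.FourManifolds.CerfGammaFourProofs
import HarnessLib

/-!
# Re-framing a framed family of spheres: Kervaire–Milnor's `φ_α(u, v) = φ(u, v · α(u))`

Topic `Literature/Topology/FourManifolds` (fact seat of
`Literature.Topology.FourManifolds.HomotopySphere.boundsContractible_of_nullCobordism_isStablyParallelizable_four`;
the input of Kervaire–Milnor's Lemma 5.4 / 6.2).  M. Kervaire, J. Milnor, *Groups of homotopy
spheres I*, Ann. of Math. 77 (1963), §6 p. 520: *"Now consider the following alteration of the
imbedding `φ`.  Let `α : Sᵖ → SO_{q+1}` be a differentiable map, and define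
`φ_α : Sᵖ × D^{q+1} → M` by `φ_α(u, v) = φ(u, v · α(u))`.  Clearly `φ_α` is an imbedding which
represents the same homotopy class `λ ∈ πₚM` as `φ`"* (p. 521).  Here for the tree's framed
families `ν : ι × Sᵏ × ℝᵐ ↪ X` (`FramedSphereFamily`) and a `C^∞` family `a i u` of linear
automorphisms of the fibre `ℝᵐ` given with its `C^∞` inverse family `b i u` (a *twist datum*,
`FramedSphereFamily.TwistData`; for `α` with values in a matrix group, `a = α`, `b = α⁻¹`):

* `FramedSphereFamily.TwistData.diffeo` — the diffeomorphism `(u, w) ↦ (u, a u w)` of `Sᵏ × ℝᵐ`;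
* `FramedSphereFamily.twist` — the re-framed family `ν_a`, `ν_a i (u, w) = ν i (u, a i u w)`
  (a smooth embedding as the composite of `ν i` with the diffeomorphism, by the tree's
  `Manifold.IsSmoothEmbedding.comp_diffeomorph`; same open image `twist_range_eq`);
* `twist_sphere`, `twist_sphereMap`, `twist_cores`, `twist_complement` — **the core spheres, hence
  the cores and their complement, are unchanged** (`a i u 0 = 0`).

Everything is proved; the `def`s/`structure` are explicit constructions; no named facts.

## References

* M. Kervaire, J. Milnor, *Groups of homotopy spheres I*, Ann. of Math. (2) 77 (1963), §6
  pp. 520–521 (the imbeddings `φ_α`). doi:10.2307/1970128 [KervaireMilnorAnnals1963]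
* A. Kosinski, *Differential Manifolds* (1993), X, proof of Lemma (2.1), p. 200. [Kosinski1993]
-/

noncomputable section

open scoped Manifold ContDiff Topology
open Set Function

namespace Literature.Topology.FourManifolds

namespace FramedSphereFamily

universe u

attribute [local instance] fact_finrank_euclideanSpace_succ

/-! ### Twist data: a smooth family of fibre automorphisms with its inverse -/

/-- A **twist datum** for `k`-spheres with `m`-dimensional fibre: a `C^∞` family
`a u : ℝᵐ →L ℝᵐ`, `u ∈ Sᵏ`, of linear maps together with a `C^∞` family `b u` of two-sided
inverses (Kervaire–Milnor's `α : Sᵖ → SO_{q+1}`, with `α⁻¹`). [cite: KervaireMilnorAnnals1963, §6 p. 520] -/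
structure TwistData (k m : ℕ) where
  /-- the fibre automorphisms -/
  a : Metric.sphere (0 : EuclideanSpace ℝ (Fin (k + 1))) 1 →
    (EuclideanSpace ℝ (Fin m) →L[ℝ] EuclideanSpace ℝ (Fin m))
  /-- their inverses -/
  b : Metric.sphere (0 : EuclideanSpace ℝ (Fin (k + 1))) 1 →
    (EuclideanSpace ℝ (Fin m) →L[ℝ] EuclideanSpace ℝ (Fin m))
  contMDiff_a : ContMDiff (𝓡 k) 𝓘(ℝ, EuclideanSpace ℝ (Fin m) →L[ℝ] EuclideanSpace ℝ (Fin m)) ∞ a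
  contMDiff_b : ContMDiff (𝓡 k) 𝓘(ℝ, EuclideanSpace ℝ (Fin m) →L[ℝ] EuclideanSpace ℝ (Fin m)) ∞ b
  a_b : ∀ u w, a u (b u w) = w
  b_a : ∀ u w, b u (a u w) = w

namespace TwistData

variable {k m : ℕ} (T : TwistData k m)

/-- The map `(u, w) ↦ (u, c u w)` is `C^∞` for a `C^∞` family of linear maps `c`. [folklore] -/
theorem contMDiff_fiberMap
    {c : Metric.sphere (0 : EuclideanSpace ℝ (Fin (k + 1))) 1 →
      (EuclideanSpace ℝ (Fin m) →L[ℝ] EuclideanSpace ℝ (Fin m))}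
    (hc : ContMDiff (𝓡 k) 𝓘(ℝ, EuclideanSpace ℝ (Fin m) →L[ℝ] EuclideanSpace ℝ (Fin m)) ∞ c) :
    ContMDiff ((𝓡 k).prod 𝓘(ℝ, EuclideanSpace ℝ (Fin m))) ((𝓡 k).prod 𝓘(ℝ, EuclideanSpace ℝ (Fin m)))
      ∞ (fun q : Metric.sphere (0 : EuclideanSpace ℝ (Fin (k + 1))) 1 × EuclideanSpace ℝ (Fin m) =>
        (q.1, c q.1 q.2)) :=
  contMDiff_fst.prodMk ((hc.comp contMDiff_fst).clm_apply contMDiff_snd)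

/-- **The fibrewise linear diffeomorphism `(u, w) ↦ (u, a u w)` of `Sᵏ × ℝᵐ`** with inverse
`(u, w) ↦ (u, b u w)`. [cite: KervaireMilnorAnnals1963, §6 p. 520] -/
def diffeo :
    (Metric.sphere (0 : EuclideanSpace ℝ (Fin (k + 1))) 1 × EuclideanSpace ℝ (Fin m)) ≃ₘ^∞⟮
      (𝓡 k).prod 𝓘(ℝ, EuclideanSpace ℝ (Fin m)), (𝓡 k).prod 𝓘(ℝ, EuclideanSpace ℝ (Fin m))⟯
      (Metric.sphere (0 : EuclideanSpace ℝ (Fin (k + 1))) 1 × EuclideanSpace ℝ (Fin m)) where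
  toFun q := (q.1, T.a q.1 q.2)
  invFun q := (q.1, T.b q.1 q.2)
  left_inv q := Prod.ext rfl (T.b_a q.1 q.2)
  right_inv q := Prod.ext rfl (T.a_b q.1 q.2)
  contMDiff_toFun := contMDiff_fiberMap T.contMDiff_a
  contMDiff_invFun := contMDiff_fiberMap T.contMDiff_b

/-- `diffeo` as a function. [folklore] -/
@[simp] theorem diffeo_apply (q : Metric.sphere (0 : EuclideanSpace ℝ (Fin (k + 1))) 1 ×
      EuclideanSpace ℝ (Fin m)) : T.diffeo q = (q.1, T.a q.1 q.2) := rfl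

end TwistData

/-! ### The re-framed family -/

section Twist

variable {EX HX : Type*} [NormedAddCommGroup EX] [NormedSpace ℝ EX] [TopologicalSpace HX]
  {IX : ModelWithCorners ℝ EX HX} {X : Type u} [TopologicalSpace X] [ChartedSpace HX X]
  {ι : Type u} {k m : ℕ}

/-- The image of a tube is unchanged by re-framing (the fibrewise maps are onto). [folklore] -/
theorem range_comp_twist_eq (ν : FramedSphereFamily IX X ι k m) (T : ι → TwistData k m) (i : ι) :
    range (fun q : Metric.sphere (0 : EuclideanSpace ℝ (Fin (k + 1))) 1 × EuclideanSpace ℝ (Fin m) =>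
        ν.toFun i (q.1, (T i).a q.1 q.2)) = range (ν.toFun i) := by
  ext x
  constructor
  · rintro ⟨q, rfl⟩
    exact ⟨_, rfl⟩
  · rintro ⟨q, rfl⟩
    exact ⟨(q.1, (T i).b q.1 q.2), by simp [(T i).a_b]⟩

/-- **The re-framed family `ν_a i (u, w) = ν i (u, a i u w)`** (Kervaire–Milnor 1963, p. 520:
`φ_α(u, v) = φ(u, v · α(u))`): again a framed family of disjoint `k`-spheres — each member is the
smooth embedding `ν i` precomposed with the diffeomorphism `(T i).diffeo`, with the same open image.
[cite: KervaireMilnorAnnals1963, §6 p. 520] -/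
def twist [IsManifold IX ∞ X] (ν : FramedSphereFamily IX X ι k m) (T : ι → TwistData k m) :
    FramedSphereFamily IX X ι k m where
  toFun i q := ν.toFun i (q.1, (T i).a q.1 q.2)
  isSmoothEmbedding i := (ν.isSmoothEmbedding i).comp_diffeomorph (T i).diffeo
  isOpen_range i := by
    rw [ν.range_comp_twist_eq T i]
    exact ν.isOpen_range i
  disjoint_range i j hij := by
    change Disjoint
      (range fun q : Metric.sphere (0 : EuclideanSpace ℝ (Fin (k + 1))) 1 × EuclideanSpace ℝ (Fin m) =>
        ν.toFun i (q.1, (T i).a q.1 q.2))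
      (range fun q : Metric.sphere (0 : EuclideanSpace ℝ (Fin (k + 1))) 1 × EuclideanSpace ℝ (Fin m) =>
        ν.toFun j (q.1, (T j).a q.1 q.2))
    rw [ν.range_comp_twist_eq T i, ν.range_comp_twist_eq T j]
    exact ν.disjoint_range hij

variable [IsManifold IX ∞ X] (ν : FramedSphereFamily IX X ι k m) (T : ι → TwistData k m)

/-- Unfolding lemma for the re-framed family. [folklore] -/
@[simp] theorem twist_toFun (i : ι)
    (q : Metric.sphere (0 : EuclideanSpace ℝ (Fin (k + 1))) 1 × EuclideanSpace ℝ (Fin m)) :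
    (ν.twist T).toFun i q = ν.toFun i (q.1, (T i).a q.1 q.2) := rfl

/-- The tubes of the re-framed family have the same images. [folklore] -/
theorem twist_range_eq (i : ι) : range ((ν.twist T).toFun i) = range (ν.toFun i) :=
  ν.range_comp_twist_eq T i

/-- **Re-framing does not change the core spheres**: `ν_a i (u, 0) = ν i (u, 0)` (Kervaire–Milnor
1963, p. 521: "`φ_α` … represents the same homotopy class `λ` as `φ`").
[cite: KervaireMilnorAnnals1963, §6 p. 521] -/
@[simp] theorem twist_sphere (i : ι) : (ν.twist T).sphere i = ν.sphere i := by
  funext u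
  simp [sphere]

/-- Re-framing does not change the union of the core spheres. [folklore] -/
@[simp] theorem twist_cores : (ν.twist T).cores = ν.cores := by
  simp [cores]

/-- Re-framing does not change the complement of the cores. [folklore] -/
theorem twist_complement [T2Space X] [Finite ι] : (ν.twist T).complement = ν.complement := by
  ext x
  simp

end Twist

section Unit

variable {EX HX : Type*} [NormedAddCommGroup EX] [NormedSpace ℝ EX] [TopologicalSpace HX]
  {IX : ModelWithCorners ℝ EX HX} {X : Type} [TopologicalSpace X] [ChartedSpace HX X]
  [IsManifold IX ∞ X] {ι : Type} [Unique ι] {k l : ℕ}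
  (ν : FramedSphereFamily IX X ι k (l + 1)) (T : ι → TwistData k (l + 1))

/-- **The core sphere as a map is unchanged by re-framing** (`sphereMap` of a one-member family),
the clause `ν'.sphereMap = ν.sphereMap` of Kervaire–Milnor's Lemma 5.4 in re-framing form.
[cite: KervaireMilnorAnnals1963, §6 p. 521] -/
@[simp] theorem twist_sphereMap : (ν.twist T).sphereMap = ν.sphereMap := by
  ext u
  simp [sphereMap]

end Unit

end FramedSphereFamily

end Literature.Topology.FourManifolds

end
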